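import Summits.QuantumFields.YangMills.Theorems.BalabanUVNodesN18BetaSuperposition
import Literature.MathematicalPhysics.QuantumFieldTheory.Balaban1983to89.T4LevelShift

/-!
# BalabanUVNodes ∕ N18 — THE TWO-RUN WINDOW LIVES ON ONE TORUS: def-B's (1.20) window under T4's diagonal level shift, and node N18's finite-volume letter
# `WindowedStepRate` (at volume shift `s = 1`) AS A WINDOWED (5.10)-TYPE BOUND FOR THE RUN-DIFFERENCE FUNCTIONAL on the torus `T^{(k+2)}_{K+1}`
# (Track A, DAG node N18 = NE5; key K3⁷ `SpineGivenEndpointR13SepCoPH` = stmt-QuantumFields-20544, skeleton v5 941dddb108cbaacf; cell `pub-ymgap`, WIDTH SEAT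
# `pub-ymgap-dag-n18-w2` g8, FILE 3; `--kind proof --supports stmt-QuantumFields-20544 --as helper`, COUNT-NEUTRAL; THEOREMS ONLY, 0 `def`, 0 `sorry`)

WHY.  W1-19b's `WindowedStepRate F ℰ ρ bV γ s κ θ C'` (def-W1 `Node00/U3KernelLetters`; the finite-volume input of node N18's letter `KernelStepRate`, dag-n18-w1's
junction `kernelStepRate_of_windowed'`, dag-n18-w2 g6's `kernelStepRate_of_geometricIncrements_of_windowed`) compares run B's windowed kernel `Π^{(K+s)}_{k+2}(w; x)` —
approximation `K + s`, unit lattice `T^{(k+2)}_{K+s}` — with run A's `Π^{(K)}_{k+1}(tail w; x)` on `T^{(k+1)}_K`.  At the volume shift `s = 1` the two unit lattices have THE SAME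
number of sites per direction, `2L^{m+K−k−1}` (`T4LevelShift.sitesPerDir_ladder`: run B started one scale finer and after one extra step sits on run A's lattice — the
pairing `j ↦ j + 1` of [I] (0.24)–(0.25)), so pub-balaban's level identification `T4LevelShift.siteShift` carries run A's functional onto run B's torus, and def-B's
window does not notice (integer labels are preserved).  Hence the two-run letter is an inequality between the (1.20) windows of TWO FUNCTIONALS ON ONE TORUS, and — the
Hessian being additive (J27 ∕ FILE 1) — a WINDOWED (5.10)-TYPE BOUND for ONE functional, the RUN DIFFERENCE `𝓓 := ℰ (k+1) w (K+1) − (ℰ k (tail w) K) ∘ shift`: C. King's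
«the error is the same graph with a difference of propagators on one line» ([King1986] p. 665) in def-B's currency, and exactly the SHAPE dag-n22-c's termwise two-point
machinery (`…N22WindowOfLocalTerms.abs_polWindow_sum_le_of_twoPointSum` ∕ the soft two-point files) consumes for the other windowed letters.

WHAT.
* §1 (hypothesis-free calculus, any field `𝕜`): `hessian_comp_continuousLinearEquiv` — `D²(f ∘ R)(x)(v, w) = D²f(Rx)(Rv, Rw)` for a continuous linear EQUIVALENCE `R`, with
  NO differentiability asked (both sides are junk together; `ContinuousLinearEquiv.comp_right_fderiv ∕ comp_fderiv` + `arrowCongr`; the `ℝ`-valued form is the tree's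
  `Literature/Topology/FourManifolds/GluingConstructionMaps.fderiv_fderiv_comp_continuousLinearEquiv_apply` — general codomain here, cited not imported) ·
  `exists_relabelCLE` (relabelling probe fields along bijections `Λ ≃ Λ'`, `T ≃ T'` is a continuous linear equivalence) · ★ `polTensor_relabel` ((1.20) of the relabelled
  functional at relabelled bonds = (1.20) of the functional).
* §2 (def-B): `expChart_relabel` · ★ `polScalar_relabel` · `contDiffAt_expChart_relabel` · `siteShift_siteOfInt` (`siteShift h (siteOfInt F K j z) = siteOfInt F K' j' z`) ·
  `contDiffAt_expChart_levelShift` · ★★ `polWindow_levelShift` — `polWindow F K' j' (W' ↦ ℰ (κ y ↦ W' κ (siteShift h y))) ρ bV μ ν z = polWindow F K j ℰ ρ bV μ ν z` for EVERY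
  functional `ℰ` (no regularity; the level-shifted probe field `κ y ↦ W' κ (siteShift h y)` is the probe-field twin of pub-balaban's `T4LevelShift.fieldShift`).
* §3 (node N18, `s = 1`): `polScalar_sub ∕ polWindow_sub` (J27's `polTensor_sub` read through def-B) · `ladder` (`T4LevelShift.sitesPerDir_ladder` at levels
  `(k+1, k+2)` of runs `(K, K+1)`) · ★★ `windowedStepRate_one_iff_sameTorus` (the letter ⟺ the same
  inequality with BOTH windows on `T^{(k+2)}_{K+1}` — pure rewriting, any `ℰ`) · ★★ `windowedStepRate_one_iff_runDifference` (charts `C²` at `0` ⟹ the letter ⟺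
  `∀ k w ∈ ]0,γ]^{k+2}, ∀ μ ν x, ∀ᶠ K, |Π^{(K+1)}_{k+2}[𝓓_{K,k,w}](x)| ≤ C'θ^k e^{−κ|x|₁}` for the run-difference functional
  `𝓓_{K,k,w} W' := ℰ (k+1) w (K+1) W' − ℰ k (tail w) K (κ y ↦ W' κ (siteShift _ y))`) · `windowedStepRate_one_of_runDifference`.
* §4 (A6 ∕ consistency, model level): `relabel_crossTermFamily` (dag-n18-w2 g7's two-bond family relabels to the two-bond family one run and one level up, same sites `e, 0`) ·
  `runDifference_cross` (its run difference IS the two-bond product with amplitude `a (k+1) w − a k (tail w)`) · `windowedStepRate_cross_one` (g7's `windowedStepRate_cross` at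
  `s = 1` RE-DERIVED through §3 — the road is non-vacuous and agrees with the closed forms).

HONEST FRAMING — what this is NOT.  Count-neutral calculus ∕ lattice bookkeeping (chain rule under a linear isomorphism; `ZMod.ringEquivCongr` preserves integer labels);
NO estimate of Bałaban's is proved or asserted — the run-difference bound itself ([I] Thm 1's uniformity in the spacing as a RATE, NOT PRINTED for d = 4) stays the
displayed hypothesis and the node's CONTENT; nothing of the merged term (1.6) constructed; no letter OF RECORD inhabited; N18 ∕ N22 ∕ (D4) NOT discharged; K3⁷ OPEN, not
claimed; counts UNMOVED (typed 28∕28 · discharged 5∕27 (A 5∕28)); one finite four-torus programme at fixed ε, Bałaban AS PRINTED; R4 closes the conditional finite-𝕋⁴ rung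
`BalabanLadder.UV` only — NOT ℝ⁴, NOT infinite volume, NOT OS, NOT a mass gap; the Clay problem is NOT proved by any of this.

References (TYPES only): [I] = [Balaban1987RG1] (0.1) p. 251, (0.24)–(0.25) p. 257, Thm 1 p. 259, (1.20)–(1.21) p. 264, (5.10) p. 293; C. King, CMP 102 (1986) [King1986]
p. 665.  Imports FILE 2 (`…N18BetaSuperposition` ⊇ FILE 1 ⊇ J27 + `Node00/U3KernelLetters2`; dag-n18-w2 g7's two-bond model for §4) and pub-balaban's
`T4LevelShift` (`siteShift ∕ coordEquiv_intCast ∕ sitesPerDir_ladder`) BY NAME; nothing re-declared.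
-/

noncomputable section

namespace YMDAG.N18.TwoRunWindowLevelShift

open Filter
open scoped BigOperators Topology
open Literature.MathematicalPhysics.QuantumFieldTheory.Balaban1983to89
open Literature.MathematicalPhysics.QuantumFieldTheory.Balaban1983to89.T4Continuum (T4Family)
open Literature.MathematicalPhysics.QuantumFieldTheory.Balaban1983to89.B12Sec2to5 (l1)
open Literature.MathematicalPhysics.QuantumFieldTheory.Balaban1983to89.FlowStep (Box HBeta)
open Literature.MathematicalPhysics.QuantumFieldTheory.Balaban1983to89.B12PolarizationTensor120 (polTensor polComp expChart)
open Literature.MathematicalPhysics.QuantumFieldTheory.Balaban1983to89.Node00 (TermFamily1 siteOfInt polScalar polWindow)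
open Literature.MathematicalPhysics.QuantumFieldTheory.Balaban1983to89.Node00.U3KernelLetters (WindowedStepRate)
open Literature.MathematicalPhysics.QuantumFieldTheory.Balaban1983to89.T4LevelShift (siteShift siteShift_apply coordEquiv_intCast sitesPerDir_ladder)
open YMDAG.N22.WindowOfLocalTerms (polTensor_sub)

/-! ## §1 Hypothesis-free calculus: the Hessian of a functional precomposed with a continuous linear equivalence -/

section Calculus

variable {𝕜 : Type*} [NontriviallyNormedField 𝕜] {E E' F' : Type*} [NormedAddCommGroup E] [NormedSpace 𝕜 E]
  [NormedAddCommGroup E'] [NormedSpace 𝕜 E'] [NormedAddCommGroup F'] [NormedSpace 𝕜 F']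

/-- **`D²(f ∘ R)(x)(v, w) = D²f(Rx)(Rv, Rw)` FOR A CONTINUOUS LINEAR EQUIVALENCE `R`, NO DIFFERENTIABILITY ASKED** (if `f` is not twice differentiable both sides are the
same junk: `ContinuousLinearEquiv.comp_right_fderiv` and `comp_fderiv` hold unconditionally).  General-codomain ∕ general-field form of the tree's `ℝ`-valued
`GluingConstructionMaps.fderiv_fderiv_comp_continuousLinearEquiv_apply`. [folklore] -/
theorem hessian_comp_continuousLinearEquiv (R : E' ≃L[𝕜] E) (f : E → F') (x v w : E') :
    fderiv 𝕜 (fderiv 𝕜 (f ∘ ⇑R)) x v w = fderiv 𝕜 (fderiv 𝕜 f) (R x) (R v) (R w) := by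
  have h1 : fderiv 𝕜 (f ∘ ⇑R) = ⇑(R.symm.arrowCongr (ContinuousLinearEquiv.refl 𝕜 F')) ∘ (fderiv 𝕜 f ∘ ⇑R) := by
    funext y
    rw [R.comp_right_fderiv]
    ext u
    simp
  rw [h1, ContinuousLinearEquiv.comp_fderiv, R.comp_right_fderiv]
  simp

variable {Λ T Λ' T' V : Type*} [NormedAddCommGroup V] [NormedSpace 𝕜 V]

/-- **RELABELLING PROBE FIELDS IS A CONTINUOUS LINEAR EQUIVALENCE**: along bijections `eΛ : Λ ≃ Λ'` of directions and `eT : T ≃ T'` of sites, `B' ↦ (ν, x) ↦ B' (eΛ ν) (eT x)`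
maps fields on the primed bonds to fields on the unprimed bonds, linearly, continuously and invertibly (the twin of `B12EuclCov567.exists_permCLM` for two index sets). [folklore] -/
theorem exists_relabelCLE (eΛ : Λ ≃ Λ') (eT : T ≃ T') :
    ∃ R : (Λ' → T' → V) ≃L[𝕜] (Λ → T → V), ∀ B' ν x, R B' ν x = B' (eΛ ν) (eT x) := by
  refine ⟨{ toFun := fun B' ν x => B' (eΛ ν) (eT x)
            invFun := fun B ν' x' => B (eΛ.symm ν') (eT.symm x')
            map_add' := fun _ _ => rfl
            map_smul' := fun _ _ => rfl
            left_inv := fun B' => by funext ν' x'; simp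
            right_inv := fun B => by funext ν x; simp
            continuous_toFun := continuous_pi fun ν => continuous_pi fun x =>
              (continuous_apply (eT x)).comp (continuous_apply (eΛ ν))
            continuous_invFun := continuous_pi fun ν' => continuous_pi fun x' =>
              (continuous_apply (eT.symm x')).comp (continuous_apply (eΛ.symm ν')) }, fun _ _ _ => rfl⟩

variable [Fintype Λ] [Fintype T] [Fintype Λ'] [Fintype T'] [DecidableEq Λ] [DecidableEq T] [DecidableEq Λ'] [DecidableEq T']

/-- ★ **(1.20) OF THE RELABELLED FUNCTIONAL AT RELABELLED BONDS IS (1.20) OF THE FUNCTIONAL**: for ANY functional `𝓔` of the probe field (no regularity),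
`Π[𝓔 ∘ relabel]_{eΛ μ, eΛ ν}(eT x, eT y)(v ⊗ w) = Π[𝓔]_{μν}(x, y)(v ⊗ w)` — a relabelling sends the one-bond direction `δ_{eΛ μ, eT x} v` to `δ_{μ, x} v`. [cite: Balaban1987RG1, (1.20) p.264] -/
theorem polTensor_relabel (eΛ : Λ ≃ Λ') (eT : T ≃ T') (𝓔 : (Λ → T → V) → F') (μ : Λ) (x : T) (v : V) (ν : Λ) (y : T) (w : V) :
    polTensor 𝕜 (fun B' : Λ' → T' → V => 𝓔 (fun κ z => B' (eΛ κ) (eT z))) (eΛ μ) (eT x) v (eΛ ν) (eT y) w = polTensor 𝕜 𝓔 μ x v ν y w := by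
  obtain ⟨R, hR⟩ := exists_relabelCLE (𝕜 := 𝕜) (V := V) eΛ eT
  have hR' : (fun B' : Λ' → T' → V => 𝓔 (fun κ z => B' (eΛ κ) (eT z))) = 𝓔 ∘ ⇑R := by
    funext B'
    simp only [Function.comp_apply]
    congr 1
    funext κ z
    exact (hR B' κ z).symm
  have hs : ∀ (κ : Λ) (z : T) (u : V), R (Pi.single (eΛ κ) (Pi.single (eT z) u)) = Pi.single κ (Pi.single z u) := by
    intro κ z u
    funext κ' z'
    rw [hR]
    by_cases hκ : κ' = κ
    · subst hκ
      by_cases hz : z' = z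
      · subst hz; simp
      · simp [hz, eT.injective.ne hz]
    · simp [hκ, eΛ.injective.ne hκ]
  rw [polTensor, polTensor, hR', hessian_comp_continuousLinearEquiv, map_zero, hs, hs]

end Calculus

/-! ## §2a T4's level shift preserves def-B's window sites (no analysis) -/

section Shift

variable (F : T4Family) {K j K' j' : ℕ}

/-- **THE LEVEL SHIFT PRESERVES def-B's WINDOW SITES**: pub-balaban's `siteShift h` (coordinatewise `ZMod.ringEquivCongr`) sends the window image `siteOfInt F K j z` of an integer
vector to `siteOfInt F K' j' z` — integer labels are preserved (`coordEquiv_intCast`). [cite: Balaban1987RG1, (0.1) p.251 and (1.21) p.264] -/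
theorem siteShift_siteOfInt (h : (F.P K).sitesPerDir j = (F.P K').sitesPerDir j') (z : Fin 4 → ℤ) :
    siteShift h (siteOfInt F K j z) = siteOfInt F K' j' z := by
  funext ν
  rw [siteShift_apply]
  simp only [Node00.siteOfInt, coordEquiv_intCast]
  rfl

end Shift

/-! ## §2b def-B's chart, scalar kernel and window under relabelling -/

section DefB

variable {𝔄 : Type*} [NormedRing 𝔄] [NormedAlgebra ℝ 𝔄] {V : Type*} [NormedAddCommGroup V] [NormedSpace ℝ V] {ι : Type*} [Fintype ι]
  {Λ T Λ' T' : Type*} [Fintype Λ] [Fintype T] [Fintype Λ'] [Fintype T'] [DecidableEq Λ] [DecidableEq T] [DecidableEq Λ'] [DecidableEq T']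

omit [Fintype Λ] [Fintype T] [Fintype Λ'] [Fintype T'] [DecidableEq Λ] [DecidableEq T] [DecidableEq Λ'] [DecidableEq T'] in
/-- The exponential chart commutes with relabelling: `expChart (ℰ ∘ relabel) ρ = (expChart ℰ ρ) ∘ relabel` (pointwise in the bond, `exp ρ` is applied entry by entry).
[cite: Balaban1987RG1, p.264 (before (1.20))] -/
theorem expChart_relabel (eΛ : Λ ≃ Λ') (eT : T ≃ T') (ℰ : (Λ → T → 𝔄) → ℝ) (ρ : V →L[ℝ] 𝔄) :
    expChart (fun W' : Λ' → T' → 𝔄 => ℰ (fun κ z => W' (eΛ κ) (eT z))) ρ = fun B' => expChart ℰ ρ (fun κ z => B' (eΛ κ) (eT z)) := by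
  funext B'; simp only [B12PolarizationTensor120.expChart_apply]

/-- ★ **def-B's SCALAR KERNEL OF THE RELABELLED FUNCTIONAL AT RELABELLED BONDS IS THE SCALAR KERNEL** (normalised colour trace of §1's `polTensor_relabel`; no regularity).
[cite: Balaban1987RG1, (1.20)–(1.21) p.264] -/
theorem polScalar_relabel (eΛ : Λ ≃ Λ') (eT : T ≃ T') (ℰ : (Λ → T → 𝔄) → ℝ) (ρ : V →L[ℝ] 𝔄) (bV : Module.Basis ι ℝ V) (μ : Λ) (x : T) (ν : Λ) (y : T) :
    polScalar (fun W' : Λ' → T' → 𝔄 => ℰ (fun κ z => W' (eΛ κ) (eT z))) ρ bV (eΛ μ) (eT x) (eΛ ν) (eT y) = polScalar ℰ ρ bV μ x ν y := by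
  simp only [polScalar, polComp, expChart_relabel, polTensor_relabel]

omit [DecidableEq Λ] [DecidableEq T] [DecidableEq Λ'] [DecidableEq T'] in
/-- A chart that is `C²` at `0` stays `C²` at `0` after relabelling (composition with a continuous linear map sending `0` to `0`). [cite: Balaban1987RG1, p.264 (before (1.20))] -/
theorem contDiffAt_expChart_relabel (eΛ : Λ ≃ Λ') (eT : T ≃ T') {ℰ : (Λ → T → 𝔄) → ℝ} {ρ : V →L[ℝ] 𝔄} {n : WithTop ℕ∞} (h : ContDiffAt ℝ n (expChart ℰ ρ) 0) :
    ContDiffAt ℝ n (expChart (fun W' : Λ' → T' → 𝔄 => ℰ (fun κ z => W' (eΛ κ) (eT z))) ρ) 0 := by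
  obtain ⟨R, hR⟩ := exists_relabelCLE (𝕜 := ℝ) (V := V) eΛ eT
  have hc : expChart (fun W' : Λ' → T' → 𝔄 => ℰ (fun κ z => W' (eΛ κ) (eT z))) ρ = expChart ℰ ρ ∘ ⇑R := by
    rw [expChart_relabel]
    funext B'
    simp only [Function.comp_apply]
    congr 1
    funext κ z
    exact (hR B' κ z).symm
  rw [hc]
  have h0 : ContDiffAt ℝ n (expChart ℰ ρ) (R 0) := by rw [map_zero]; exact h
  exact h0.comp 0 R.contDiff.contDiffAt

variable (F : T4Family) {K j K' j' : ℕ}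

/-- The chart of the level-shifted functional `W' ↦ ℰ (κ y ↦ W' κ (siteShift h y))` is `C²` at `0` when the chart of `ℰ` is (§1's relabelling along `(Equiv.refl, siteShift h)`;
the direction index types of all runs are `Fin 4` by `T4Family.P_d`). [cite: Balaban1987RG1, p.264 (before (1.20))] -/
theorem contDiffAt_expChart_levelShift (h : (F.P K).sitesPerDir j = (F.P K').sitesPerDir j') {ℰ : (Fin (F.P K).d → Site (F.P K) j → 𝔄) → ℝ} {ρ : V →L[ℝ] 𝔄}
    {n : WithTop ℕ∞} (hℰ : ContDiffAt ℝ n (expChart ℰ ρ) 0) :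
    ContDiffAt ℝ n (expChart (fun W' : Fin (F.P K').d → Site (F.P K') j' → 𝔄 => ℰ (fun κ y => W' κ (siteShift h y))) ρ) 0 :=
  contDiffAt_expChart_relabel (Equiv.refl (Fin 4)) (siteShift h) hℰ

/-- ★★ **def-B's WINDOW DOES NOT NOTICE THE LEVEL SHIFT**: for EVERY functional `ℰ` on the `𝔄`-valued probe fields of `T^{(j)}_K` (no regularity asked), the functional
`W' ↦ ℰ (κ y ↦ W' κ (siteShift h y))` on the probe fields of `T^{(j')}_{K'}` (equal modulus) has the same windowed kernel at every direction pair and integer separation: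
`Π^{(K')}_{j'}[ℰ ∘ shift](z) = Π^{(K)}_{j}[ℰ](z)`. [cite: Balaban1987RG1, (1.20)–(1.21) p.264 and (0.1) p.251] -/
theorem polWindow_levelShift (h : (F.P K).sitesPerDir j = (F.P K').sitesPerDir j') (ℰ : (Fin (F.P K).d → Site (F.P K) j → 𝔄) → ℝ) (ρ : V →L[ℝ] 𝔄)
    (bV : Module.Basis ι ℝ V) (μ ν : Fin 4) (z : Fin 4 → ℤ) :
    polWindow F K' j' (fun W' : Fin (F.P K').d → Site (F.P K') j' → 𝔄 => ℰ (fun κ y => W' κ (siteShift h y))) ρ bV μ ν z = polWindow F K j ℰ ρ bV μ ν z := by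
  have hx := polScalar_relabel (Equiv.refl (Fin 4)) (siteShift h) ℰ ρ bV (Fin.cast (F.P_d K).symm μ) (siteOfInt F K j z) (Fin.cast (F.P_d K).symm ν) (siteOfInt F K j 0)
  rw [siteShift_siteOfInt, siteShift_siteOfInt] at hx
  exact hx

end DefB

/-! ## §3 Node N18: the two-run letter at `s = 1` on ONE torus, and as a windowed bound for the run-difference functional -/

section TwoRuns

variable {𝔄 : Type*} [NormedRing 𝔄] [NormedAlgebra ℝ 𝔄] {V : Type*} [NormedAddCommGroup V] [NormedSpace ℝ V] {ι : Type*} [Fintype ι]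
  {Λ T : Type*} [Fintype Λ] [Fintype T] [DecidableEq Λ] [DecidableEq T]

/-- def-B's scalar kernel of a DIFFERENCE of two functionals with `C²` charts (J27's `polTensor_sub` through the normalised colour trace). [cite: Balaban1987RG1, (1.20) p.264] -/
theorem polScalar_sub (ℰ₁ ℰ₂ : (Λ → T → 𝔄) → ℝ) (ρ : V →L[ℝ] 𝔄) (bV : Module.Basis ι ℝ V)
    (h₁ : ContDiffAt ℝ 2 (expChart ℰ₁ ρ) 0) (h₂ : ContDiffAt ℝ 2 (expChart ℰ₂ ρ) 0) (μ : Λ) (x : T) (ν : Λ) (y : T) :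
    polScalar (fun U => ℰ₁ U - ℰ₂ U) ρ bV μ x ν y = polScalar ℰ₁ ρ bV μ x ν y - polScalar ℰ₂ ρ bV μ x ν y := by
  have hc : expChart (fun U => ℰ₁ U - ℰ₂ U) ρ = fun B => expChart ℰ₁ ρ B - expChart ℰ₂ ρ B := by
    funext B; simp only [B12PolarizationTensor120.expChart_apply]
  simp only [polScalar, polComp, hc, polTensor_sub ℝ _ _ h₁ h₂, Finset.sum_sub_distrib, mul_sub]

variable (F : T4Family)

/-- def-B's windowed kernel of a DIFFERENCE of two functionals on one torus (`C²` charts). [cite: Balaban1987RG1, (1.20)–(1.21) p.264] -/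
theorem polWindow_sub (K j : ℕ) (ℰ₁ ℰ₂ : (Fin (F.P K).d → Site (F.P K) j → 𝔄) → ℝ) (ρ : V →L[ℝ] 𝔄) (bV : Module.Basis ι ℝ V)
    (h₁ : ContDiffAt ℝ 2 (expChart ℰ₁ ρ) 0) (h₂ : ContDiffAt ℝ 2 (expChart ℰ₂ ρ) 0) (μ ν : Fin 4) (z : Fin 4 → ℤ) :
    polWindow F K j (fun U => ℰ₁ U - ℰ₂ U) ρ bV μ ν z = polWindow F K j ℰ₁ ρ bV μ ν z - polWindow F K j ℰ₂ ρ bV μ ν z := by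
  unfold polWindow
  exact polScalar_sub ℰ₁ ℰ₂ ρ bV h₁ h₂ _ _ _ _

/-- **THE DIAGONAL LADDER** (`T4LevelShift.sitesPerDir_ladder`): run A's level-`(k+1)` lattice at approximation `K` and run B's level-`(k+2)` lattice at approximation
`K + 1` have the same number of sites per direction. [cite: Balaban1987RG1, (0.1) p.251 and (0.24)–(0.25) p.257] -/
theorem ladder (K k : ℕ) : (F.P K).sitesPerDir (k + 1) = (F.P (K + 1)).sitesPerDir (k + 1 + 1) :=
  sitesPerDir_ladder F rfl rfl

variable (ℰ : TermFamily1 F 𝔄) (ρ : V →L[ℝ] 𝔄) (bV : Module.Basis ι ℝ V)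

/-- ★★ **THE TWO-RUN LETTER AT `s = 1` ON ONE TORUS**: W1-19b's `WindowedStepRate F ℰ ρ bV γ 1 κ θ C'` is — word for word — the same inequality with run A's window READ ON
run B's torus `T^{(k+2)}_{K+1}` through the level shift along `ladder F K k` (§2's `polWindow_levelShift`; pure rewriting, EVERY term family).
[cite: Balaban1987RG1, Thm 1 p.259 and (1.20)–(1.21) p.264] -/
theorem windowedStepRate_one_iff_sameTorus (γ κ θ C' : ℝ) :
    WindowedStepRate F ℰ ρ bV γ 1 κ θ C' ↔
      ∀ (k : ℕ) (w : Fin (k + 2) → ℝ), w ∈ Box γ (k + 1) → ∀ (μ ν : Fin 4) (x : Fin 4 → ℤ), ∀ᶠ K in atTop,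
        |polWindow F (K + 1) (k + 1 + 1) (ℰ (k + 1) w (K + 1)) ρ bV μ ν x -
            polWindow F (K + 1) (k + 1 + 1)
              (fun W' : Fin (F.P (K + 1)).d → Site (F.P (K + 1)) (k + 1 + 1) → 𝔄 => ℰ k (Fin.tail w) K (fun κ y => W' κ (siteShift (ladder F K k) y))) ρ bV μ ν x| ≤
          C' * θ ^ k * Real.exp (-κ * l1 x) := by
  simp only [WindowedStepRate, polWindow_levelShift]

/-- ★★ **NODE N18's FINITE-VOLUME LETTER AS A WINDOWED (5.10)-TYPE BOUND FOR THE RUN-DIFFERENCE FUNCTIONAL** (charts `C²` at `0`): `WindowedStepRate F ℰ ρ bV γ 1 κ θ C'`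
holds iff for every box history `w ∈ ]0, γ]^{k+2}`, direction pair and separation, EVENTUALLY in `K`, the windowed kernel ON `T^{(k+2)}_{K+1}` of the ONE functional
`𝓓_{K,k,w} := ℰ (k+1) w (K+1) − (ℰ k (tail w) K) ∘ shift` is bounded by `C'θ^k e^{−κ|x|₁}` — King's «difference of propagators on one line» in def-B's currency.
[cite: Balaban1987RG1, Thm 1 p.259, (1.20)–(1.21) p.264 and (5.10) p.293; King1986, p.665] -/
theorem windowedStepRate_one_iff_runDifference (hC : ∀ k hist K, ContDiffAt ℝ 2 (expChart (ℰ k hist K) ρ) 0) (γ κ θ C' : ℝ) :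
    WindowedStepRate F ℰ ρ bV γ 1 κ θ C' ↔
      ∀ (k : ℕ) (w : Fin (k + 2) → ℝ), w ∈ Box γ (k + 1) → ∀ (μ ν : Fin 4) (x : Fin 4 → ℤ), ∀ᶠ K in atTop,
        |polWindow F (K + 1) (k + 1 + 1)
            (fun W' : Fin (F.P (K + 1)).d → Site (F.P (K + 1)) (k + 1 + 1) → 𝔄 =>
              ℰ (k + 1) w (K + 1) W' - ℰ k (Fin.tail w) K (fun κ y => W' κ (siteShift (ladder F K k) y))) ρ bV μ ν x| ≤
          C' * θ ^ k * Real.exp (-κ * l1 x) := by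
  rw [windowedStepRate_one_iff_sameTorus]
  refine forall₃_congr fun k w _ => forall₃_congr fun μ ν x => ?_
  refine Filter.eventually_congr (Eventually.of_forall fun K => ?_)
  rw [polWindow_sub F (K + 1) (k + 1 + 1) (ℰ (k + 1) w (K + 1))
    (fun W' : Fin (F.P (K + 1)).d → Site (F.P (K + 1)) (k + 1 + 1) → 𝔄 => ℰ k (Fin.tail w) K (fun κ y => W' κ (siteShift (ladder F K k) y))) ρ bV
    (hC (k + 1) w (K + 1)) (contDiffAt_expChart_levelShift F (ladder F K k) (hC k (Fin.tail w) K))]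

/-- The producer's direction alone: a windowed bound for the run-difference functionals gives the letter. [cite: Balaban1987RG1, Thm 1 p.259 and (5.10) p.293] -/
theorem windowedStepRate_one_of_runDifference (hC : ∀ k hist K, ContDiffAt ℝ 2 (expChart (ℰ k hist K) ρ) 0) {γ κ θ C' : ℝ}
    (h : ∀ (k : ℕ) (w : Fin (k + 2) → ℝ), w ∈ Box γ (k + 1) → ∀ (μ ν : Fin 4) (x : Fin 4 → ℤ), ∀ᶠ K in atTop,
      |polWindow F (K + 1) (k + 1 + 1)
          (fun W' : Fin (F.P (K + 1)).d → Site (F.P (K + 1)) (k + 1 + 1) → 𝔄 =>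
            ℰ (k + 1) w (K + 1) W' - ℰ k (Fin.tail w) K (fun κ y => W' κ (siteShift (ladder F K k) y))) ρ bV μ ν x| ≤
        C' * θ ^ k * Real.exp (-κ * l1 x)) :
    WindowedStepRate F ℰ ρ bV γ 1 κ θ C' :=
  (windowedStepRate_one_iff_runDifference F ℰ ρ bV hC γ κ θ C').2 h

end TwoRuns

/-! ## §4 Model check (A6): the road at dag-n18-w2 g7's two-bond family reproduces the closed-form step rate -/

section Model

open YMDAG.N18.RunningBetaLettersModel (crossTermFamily crossKernel polWindow_crossTermFamily_eventually abs_crossKernel_le wt wt_nonneg)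
open YMDAG.N18.BetaSuperposition (contDiffAt_expChart_crossTermFamily)

variable (F : T4Family)

/-- **THE TWO-BOND FAMILY RELABELS TO ITSELF ONE RUN AND ONE LEVEL UP**: run A's level-`k` functional at `(K, v)` read on run B's torus `T^{(k+2)}_{K+1}` is the two-bond product
at the SAME integer sites `e, 0` with the SAME amplitude `a k v`, i.e. the two-bond family with the constant law `a k v` one level and one run up.
[cite: Balaban1987RG1, (1.20)–(1.21) p.264; model] -/
theorem relabel_crossTermFamily (a : HBeta) (e : Fin 4 → ℤ) (K k : ℕ) (v : Fin (k + 1) → ℝ) (w : Fin (k + 2) → ℝ) :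
    (fun W' : Fin (F.P (K + 1)).d → Site (F.P (K + 1)) (k + 1 + 1) → ℝ => crossTermFamily F a e k v K (fun κ y => W' κ (siteShift (ladder F K k) y))) =
      crossTermFamily F (fun _ _ => a k v) e (k + 1) w (K + 1) := by
  funext W'
  simp only [crossTermFamily, siteShift_siteOfInt]
  rfl

/-- **THE RUN DIFFERENCE OF THE TWO-BOND FAMILY IS THE TWO-BOND PRODUCT WITH THE AMPLITUDE DIFFERENCE** `a (k+1) w − a k (tail w)` (the two-bond family one level up with
that constant law). [cite: Balaban1987RG1, (1.20) p.264; model] -/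
theorem runDifference_cross (a : HBeta) (e : Fin 4 → ℤ) (K k : ℕ) (w : Fin (k + 2) → ℝ) :
    (fun W' : Fin (F.P (K + 1)).d → Site (F.P (K + 1)) (k + 1 + 1) → ℝ =>
        crossTermFamily F a e (k + 1) w (K + 1) W' - crossTermFamily F a e k (Fin.tail w) K (fun κ y => W' κ (siteShift (ladder F K k) y))) =
      crossTermFamily F (fun _ _ => a (k + 1) w - a k (Fin.tail w)) e (k + 1) w (K + 1) := by
  funext W'
  have h := congrFun (relabel_crossTermFamily F a e K k (Fin.tail w) w) W'
  rw [h]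
  simp only [crossTermFamily]
  ring

/-- **g7's `windowedStepRate_cross` AT `s = 1`, RE-DERIVED THROUGH THE RUN-DIFFERENCE ROAD** (non-vacuity and consistency of §3): a two-run contracting amplitude law
`|a (k+1) w − a k (tail w)| ≤ C θ θ^k` on the boxes gives the letter with constant `(C·wt κ e)·θ` — the run-difference functional's window is eventually
`crossKernel (a (k+1) w − a k (tail w)) e`. [cite: Balaban1987RG1, Thm 1 p.259; model] -/
theorem windowedStepRate_cross_one {a : HBeta} {γ θ C : ℝ} (ha : ∀ (k : ℕ) (w : Fin (k + 2) → ℝ), w ∈ Box γ (k + 1) → |a (k + 1) w - a k (Fin.tail w)| ≤ C * θ * θ ^ k)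
    (e : Fin 4 → ℤ) (κ : ℝ) :
    WindowedStepRate F (crossTermFamily F a e) (ContinuousLinearMap.id ℝ ℝ) (Module.Basis.singleton Unit ℝ) γ 1 κ θ ((C * wt κ e) * θ) := by
  refine windowedStepRate_one_of_runDifference F _ _ _ (contDiffAt_expChart_crossTermFamily F a e) fun k w hw μ ν x => ?_
  have hfun : ∀ K : ℕ, polWindow F (K + 1) (k + 1 + 1)
      (fun W' : Fin (F.P (K + 1)).d → Site (F.P (K + 1)) (k + 1 + 1) → ℝ =>
        crossTermFamily F a e (k + 1) w (K + 1) W' - crossTermFamily F a e k (Fin.tail w) K (fun κ y => W' κ (siteShift (ladder F K k) y)))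
      (ContinuousLinearMap.id ℝ ℝ) (Module.Basis.singleton Unit ℝ) μ ν x =
      polWindow F (K + 1) (k + 1 + 1) (crossTermFamily F (fun _ _ => a (k + 1) w - a k (Fin.tail w)) e (k + 1) w (K + 1))
        (ContinuousLinearMap.id ℝ ℝ) (Module.Basis.singleton Unit ℝ) μ ν x := fun K =>
    congrArg (fun 𝓔 => polWindow F (K + 1) (k + 1 + 1) 𝓔 (ContinuousLinearMap.id ℝ ℝ) (Module.Basis.singleton Unit ℝ) μ ν x) (runDifference_cross F a e K k w)
  obtain ⟨K₁, hK₁⟩ := eventually_atTop.1 (polWindow_crossTermFamily_eventually F (fun _ _ => a (k + 1) w - a k (Fin.tail w)) e (k + 1) w μ ν x)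
  refine eventually_atTop.2 ⟨K₁, fun K hK => ?_⟩
  rw [hfun K, hK₁ (K + 1) (le_trans hK (Nat.le_succ K)), neg_mul]
  refine (abs_crossKernel_le _ e μ ν x κ).trans ?_
  have h := mul_le_mul_of_nonneg_right (mul_le_mul_of_nonneg_right (ha k w hw) (wt_nonneg κ e)) (Real.exp_nonneg (-(κ * l1 x)))
  calc _ ≤ C * θ * θ ^ k * wt κ e * Real.exp (-(κ * l1 x)) := h
    _ = C * wt κ e * θ * θ ^ k * Real.exp (-(κ * l1 x)) := by ring

end Model

end YMDAG.N18.TwoRunWindowLevelShift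

end
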